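import Summits.Ventures.PercRepro.SixFourResidueFourBetaTableA
import Summits.Ventures.PercRepro.SixFourResidueFourBetaTableB
import Summits.Ventures.PercRepro.SixFourResidueFourBetaTail

/-!
# `PlaneAddTwoFour` — Theorem 21.6 at `t = 4` for every plane size, part 6: the assembly (p1, gen 7)

A one-long-line certificate `BetaCert4N p a b` exists for every `p ≥ 4` (`betaCert4_exists`: the tables for
`4 ≤ p ≤ 100`, the tail `(−p·2^h, 1)` for `p ≥ 101`), so **Theorem 21.6 at `t = 4` holds for every plane size**
(`J_four_nonneg_of_plane_add_two_all`: `0 ≤ J₄(G)` whenever some plane trace has `g − 2` points — p2's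
`J_four_nonneg_of_plane_add_two` for `g ≤ 9`, the certificate otherwise), and the (β) piece of the big-plane clause of
`SixFourResidue` is discharged: **`planeAddTwoFour_holds : PlaneAddTwoFour`** (p3's `SixFourResidueBigPlane`).
-/

namespace PercRepro.SixFour

/-- A one-long-line certificate exists at `t = 4` for every plane size `p ≥ 4`. -/
theorem betaCert4_exists {p : ℕ} (hp : 4 ≤ p) : ∃ a b, BetaCert4N p a b := by
  rcases Nat.lt_or_ge 60 p with h | h
  · rcases Nat.lt_or_ge 100 p with h' | h'
    · exact ⟨_, _, betaCert4_tail (by omega)⟩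
    · exact betaCert4_of_range_B (by omega) h'
  · exact betaCert4_of_range_A hp h

open Finset ThmH

variable {α : Type*} [DecidableEq α] {M : Matroid α} [M.Finite] {G : Finset α}

/-- **Theorem 21.6 at `t = 4`, every plane size (§21.6, §21.18.3 (β) `k = 2`)**: if some plane trace has `g − 2` points,
`0 ≤ J₄(G)`. -/
theorem J_four_nonneg_of_plane_add_two_all (hs : Simple M) (hG : G ⊆ gr M) (hr : M.eRk (G : Set α) = 4) {P₀ : Finset α}
    (hP₀ : P₀ ∈ planes M) (hcard : (P₀ ∩ G).card + 2 = G.card) : 0 ≤ J M G 4 := by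
  rcases Nat.lt_or_ge 9 G.card with h9 | h9
  · obtain ⟨a, b, hcert⟩ := betaCert4_exists (p := (P₀ ∩ G).card) (by omega)
    exact J_four_nonneg_of_plane_add_two_of_cert hs hG hr hP₀ hcard hcert
  · exact J_four_nonneg_of_plane_add_two hs hG hr hP₀ hcard h9

/-- **`PlaneAddTwoFour` holds**: Theorem 21.6 at `t = 4` for every rank-`4` set with `≥ 10` points and a plane trace of
exactly `g − 2` points. -/
theorem planeAddTwoFour_holds : PlaneAddTwoFour := by
  intro β _ M _ G hs hG hr P hP hcard _
  exact J_four_nonneg_of_plane_add_two_all hs hG hr hP hcard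

end PercRepro.SixFour
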